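import Summits.AtomisticToContinuum.HydrodynamicLimit.Theorems.LambertianContactSwapLambertianEulerGibbsInsertionZip
import Summits.AtomisticToContinuum.HydrodynamicLimit.Theorems.LambertianContactSwapLambertianEulerStarShells
import Mathlib.Data.Fin.VecNotation
import HarnessLib

/-!
# The static bound behind the marked Lambertian contacts
# (`LambertianContactSwap.LambertianEuler`, stmt-AtomisticToContinuum-11854, line `Sketch`; lead c10,
# piece W9 part 1: registered stub `localGibbsLaw_markedShell_le`)

Support file (`--supports stmt-AtomisticToContinuum-11854`).  A counted Lambertian collision is MARKED
(cell width `δ`, fast threshold `L`) when a third particle sits in the velocity shell of width `δ` of a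
colliding particle at the exit configuration, or the pair is fast (`L ≤ δ ‖Δv‖`).  Transported to a
mesh time `h' ≤ δ` earlier (`…ConfigMarkedKorolyuk`) the event to estimate under the rung-0 local Gibbs
law `G` is `{h'-shell of (i,j)} ∩ ({∃ r ∉ {i,j}, 2δ-shell of (i,r) or (j,r)} ∪ {L ≤ δ‖v_i − v_j‖})`,
the `w`-shell of `(a,b)` being `ε ≤ d(x_a,x_b) ≤ ε + w‖v_a − v_b‖`, `ε = hsDiameter σ N`.  We prove
`G(event) ≤ C ((N+1) ε⁴ δ + ε² δ²/L²) h'` (`localGibbsLaw_markedShell_le`): the three-body pieces are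
stars (`…StarShells.pi_starShells_le`, `m = 2`, insertion factor `2³` by
`…GibbsInsertionZip.localGibbsLaw_le_pow_mul_pi`), the fast piece is dominated by
`(δ/L)²(1 + ‖v_i‖ + ‖v_j‖)²` on the shell (`m = 1`, exponent `2`, factor `2²`).
References: Cercignani–Illner–Pulvirenti 1994 §2.2; Gallagher–Saint-Raymond–Texier 2013 Lemma 4.1.2;
Pulvirenti–Tsagkarogiannis 2012 §3.  All statements [folklore].
-/

noncomputable section

namespace Summit.AtomisticToContinuum.HydrodynamicLimit.Theorems.LambertianContactSwapLambertianEulerMarkedContactsStatics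

open scoped BigOperators Topology ENNReal InnerProductSpace
open MeasureTheory ProbabilityTheory Filter Set
open Literature.MathematicalPhysics.KineticTheory Literature.MathematicalPhysics.StatisticalMechanics
open Literature.Analysis.FluidPDE
open Summit.AtomisticToContinuum.HydrodynamicLimit.Theorems.LambertianContactSwapLambertianEulerGibbsInsertionZip
open Summit.AtomisticToContinuum.HydrodynamicLimit.Theorems.LambertianContactSwapLambertianEulerStarShells

/-! ## Shells: measurability and symmetry -/

/-- The velocity shell `ε ≤ d(x_i, x_j) ≤ ε + w ‖v_i − v_j‖` is a measurable set of configurations.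
[folklore] -/
theorem measurableSet_velShell (n : ℕ) (ε w : ℝ) (i j : Fin n) :
    MeasurableSet {y : Config n (Fin 3) T3 | ε ≤ ‖(Torus.geometry (Fin 3)).sepVec (y i).1 (y j).1‖ ∧
      ‖(Torus.geometry (Fin 3)).sepVec (y i).1 (y j).1‖ ≤ ε + w * ‖(y i).2 - (y j).2‖} := by
  have hd : Measurable fun y : Config n (Fin 3) T3 => ‖(Torus.geometry (Fin 3)).sepVec (y i).1 (y j).1‖ :=
    (Torus.measurable_geometry_sepVec.comp
      ((measurable_pi_apply i).fst.prodMk (measurable_pi_apply j).fst)).norm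
  have hr : Measurable fun y : Config n (Fin 3) T3 => ε + w * ‖(y i).2 - (y j).2‖ :=
    measurable_const.add (((measurable_pi_apply i).snd.sub (measurable_pi_apply j).snd).norm.const_mul w)
  exact (measurableSet_le measurable_const hd).inter (measurableSet_le hd hr)

/-- The velocity shell is symmetric in the two particles (the minimal-image distance and the relative
speed are symmetric). [folklore] -/
theorem velShell_symm {n : ℕ} {ε w : ℝ} {i j : Fin n} {y : Config n (Fin 3) T3}
    (h : ε ≤ ‖(Torus.geometry (Fin 3)).sepVec (y i).1 (y j).1‖ ∧
      ‖(Torus.geometry (Fin 3)).sepVec (y i).1 (y j).1‖ ≤ ε + w * ‖(y i).2 - (y j).2‖) :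
    ε ≤ ‖(Torus.geometry (Fin 3)).sepVec (y j).1 (y i).1‖ ∧
      ‖(Torus.geometry (Fin 3)).sepVec (y j).1 (y i).1‖ ≤ ε + w * ‖(y j).2 - (y i).2‖ := by
  rw [Torus.norm_geometry_sepVec, Torus.euclidDist_comm, ← Torus.norm_geometry_sepVec, norm_sub_rev]
  exact h

/-! ## The free-law weights of the two pieces -/

/-- **Three-body piece under the free law.**  For distinct `a, b, r` the event
`{w₁-shell of (a, b)} ∩ {w₂-shell of (a, r)}` (widths `≤ ε ≤ 1/4`) is a star with centre `a`, so its
free-law probability is `≤ C₂ ε⁴ w₁ w₂` (`pi_starShells_le` with `m = 2`, exponent `0`). [folklore] -/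
theorem pi_twoShells_le (w : V3) (ϑ : ℝ) {C₂ : ℝ}
    (hC₂ : ∀ (n : ℕ) (ε : ℝ), 0 < ε → ε ≤ 1 / 4 →
      ∀ (a : Fin n) (bs : Fin 2 → Fin n), Function.Injective bs → (∀ i, bs i ≠ a) →
      ∀ δs : Fin 2 → ℝ, (∀ i, 0 ≤ δs i) → (∀ i, δs i ≤ ε) →
        ∫⁻ y, {y : Config n (Fin 3) T3 | ∀ i, ε ≤ ‖(Torus.geometry (Fin 3)).sepVec (y a).1 (y (bs i)).1‖ ∧
                ‖(Torus.geometry (Fin 3)).sepVec (y a).1 (y (bs i)).1‖ ≤ ε + δs i * ‖(y a).2 - (y (bs i)).2‖}.indicator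
              (fun y => ENNReal.ofReal ((1 + ‖(y a).2‖ + ∑ i, ‖(y (bs i)).2‖) ^ 0)) y
          ∂Measure.pi (fun _ : Fin n => (volume : Measure T3).prod (gaussMeasure w ϑ)) ≤
        ENNReal.ofReal (C₂ * ε ^ (2 * 2) * ∏ i, δs i))
    {n : ℕ} {ε w₁ w₂ : ℝ} (hε : 0 < ε) (hε4 : ε ≤ 1 / 4) (hw₁ : 0 ≤ w₁) (hw₁ε : w₁ ≤ ε)
    (hw₂ : 0 ≤ w₂) (hw₂ε : w₂ ≤ ε) {a b r : Fin n} (hab : b ≠ a) (har : r ≠ a) (hbr : b ≠ r) :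
    Measure.pi (fun _ : Fin n => (volume : Measure T3).prod (gaussMeasure w ϑ))
        ({y : Config n (Fin 3) T3 | ε ≤ ‖(Torus.geometry (Fin 3)).sepVec (y a).1 (y b).1‖ ∧
            ‖(Torus.geometry (Fin 3)).sepVec (y a).1 (y b).1‖ ≤ ε + w₁ * ‖(y a).2 - (y b).2‖} ∩
          {y | ε ≤ ‖(Torus.geometry (Fin 3)).sepVec (y a).1 (y r).1‖ ∧
            ‖(Torus.geometry (Fin 3)).sepVec (y a).1 (y r).1‖ ≤ ε + w₂ * ‖(y a).2 - (y r).2‖}) ≤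
      ENNReal.ofReal (C₂ * ε ^ 4 * (w₁ * w₂)) := by
  set U := Measure.pi (fun _ : Fin n => (volume : Measure T3).prod (gaussMeasure w ϑ)) with hU
  set bs : Fin 2 → Fin n := ![b, r] with hbs
  set δs : Fin 2 → ℝ := ![w₁, w₂] with hδs
  have hinj : Function.Injective bs := by
    intro i j hij
    fin_cases i <;> fin_cases j <;> first | rfl | exact absurd hij (by simp [hbs, hbr, hbr.symm])
  have hne : ∀ i, bs i ≠ a := fun i => by fin_cases i <;> simp [hbs, hab, har]
  have hδ0 : ∀ i, 0 ≤ δs i := fun i => by fin_cases i <;> simp [hδs, hw₁, hw₂]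
  have hδε : ∀ i, δs i ≤ ε := fun i => by fin_cases i <;> simp [hδs, hw₁ε, hw₂ε]
  set S : Set (Config n (Fin 3) T3) := {y | ∀ i, ε ≤ ‖(Torus.geometry (Fin 3)).sepVec (y a).1 (y (bs i)).1‖ ∧
      ‖(Torus.geometry (Fin 3)).sepVec (y a).1 (y (bs i)).1‖ ≤ ε + δs i * ‖(y a).2 - (y (bs i)).2‖} with hS
  have hSm : MeasurableSet S := by
    have : S = ⋂ i, {y : Config n (Fin 3) T3 | ε ≤ ‖(Torus.geometry (Fin 3)).sepVec (y a).1 (y (bs i)).1‖ ∧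
        ‖(Torus.geometry (Fin 3)).sepVec (y a).1 (y (bs i)).1‖ ≤ ε + δs i * ‖(y a).2 - (y (bs i)).2‖} := by
      ext y; simp [hS]
    rw [this]
    exact MeasurableSet.iInter fun i => measurableSet_velShell n ε (δs i) a (bs i)
  have hsub : ({y : Config n (Fin 3) T3 | ε ≤ ‖(Torus.geometry (Fin 3)).sepVec (y a).1 (y b).1‖ ∧
            ‖(Torus.geometry (Fin 3)).sepVec (y a).1 (y b).1‖ ≤ ε + w₁ * ‖(y a).2 - (y b).2‖} ∩
          {y | ε ≤ ‖(Torus.geometry (Fin 3)).sepVec (y a).1 (y r).1‖ ∧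
            ‖(Torus.geometry (Fin 3)).sepVec (y a).1 (y r).1‖ ≤ ε + w₂ * ‖(y a).2 - (y r).2‖}) ⊆ S := by
    intro y hy i
    fin_cases i
    · simpa [hbs, hδs] using hy.1
    · simpa [hbs, hδs] using hy.2
  have hkey := hC₂ n ε hε hε4 a bs hinj hne δs hδ0 hδε
  have hint : ∫⁻ y, S.indicator (fun y => ENNReal.ofReal ((1 + ‖(y a).2‖ + ∑ i, ‖(y (bs i)).2‖) ^ 0)) y ∂U =
      U S := by
    have : S.indicator (fun y : Config n (Fin 3) T3 =>
        ENNReal.ofReal ((1 + ‖(y a).2‖ + ∑ i, ‖(y (bs i)).2‖) ^ 0)) = S.indicator 1 := by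
      funext y
      simp only [pow_zero, ENNReal.ofReal_one]
      rfl
    rw [this, lintegral_indicator_one hSm]
  have hprod : ∏ i, δs i = w₁ * w₂ := by rw [Fin.prod_univ_two]; simp [hδs]
  calc U _ ≤ U S := measure_mono hsub
    _ = ∫⁻ y, S.indicator (fun y => ENNReal.ofReal ((1 + ‖(y a).2‖ + ∑ i, ‖(y (bs i)).2‖) ^ 0)) y ∂U := hint.symm
    _ ≤ ENNReal.ofReal (C₂ * ε ^ (2 * 2) * ∏ i, δs i) := hkey
    _ = ENNReal.ofReal (C₂ * ε ^ 4 * (w₁ * w₂)) := by rw [hprod]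

/-- **Fast piece under the free law.**  For `a ≠ b`, `0 < L` and `0 ≤ δ`, the event
`{w₁-shell of (a, b)} ∩ {L ≤ δ ‖v_a − v_b‖}` is dominated pointwise by
`(δ/L)² (1 + ‖v_a‖ + ‖v_b‖)²` times the shell indicator, so its free-law probability is
`≤ (δ/L)² C₁ ε² w₁` (`pi_starShells_le` with `m = 1`, exponent `2`). [folklore] -/
theorem pi_fastShell_le (w : V3) (ϑ : ℝ) {C₁ : ℝ}
    (hC₁ : ∀ (n : ℕ) (ε : ℝ), 0 < ε → ε ≤ 1 / 4 →
      ∀ (a : Fin n) (bs : Fin 1 → Fin n), Function.Injective bs → (∀ i, bs i ≠ a) →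
      ∀ δs : Fin 1 → ℝ, (∀ i, 0 ≤ δs i) → (∀ i, δs i ≤ ε) →
        ∫⁻ y, {y : Config n (Fin 3) T3 | ∀ i, ε ≤ ‖(Torus.geometry (Fin 3)).sepVec (y a).1 (y (bs i)).1‖ ∧
                ‖(Torus.geometry (Fin 3)).sepVec (y a).1 (y (bs i)).1‖ ≤ ε + δs i * ‖(y a).2 - (y (bs i)).2‖}.indicator
              (fun y => ENNReal.ofReal ((1 + ‖(y a).2‖ + ∑ i, ‖(y (bs i)).2‖) ^ 2)) y
          ∂Measure.pi (fun _ : Fin n => (volume : Measure T3).prod (gaussMeasure w ϑ)) ≤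
        ENNReal.ofReal (C₁ * ε ^ (2 * 1) * ∏ i, δs i))
    {n : ℕ} {ε w₁ δ L : ℝ} (hε : 0 < ε) (hε4 : ε ≤ 1 / 4) (hw₁ : 0 ≤ w₁) (hw₁ε : w₁ ≤ ε)
    (hδ : 0 ≤ δ) (hL : 0 < L) {a b : Fin n} (hab : b ≠ a) :
    Measure.pi (fun _ : Fin n => (volume : Measure T3).prod (gaussMeasure w ϑ))
        ({y : Config n (Fin 3) T3 | ε ≤ ‖(Torus.geometry (Fin 3)).sepVec (y a).1 (y b).1‖ ∧
            ‖(Torus.geometry (Fin 3)).sepVec (y a).1 (y b).1‖ ≤ ε + w₁ * ‖(y a).2 - (y b).2‖} ∩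
          {y | L ≤ δ * ‖(y a).2 - (y b).2‖}) ≤
      ENNReal.ofReal ((δ / L) ^ 2 * (C₁ * ε ^ 2 * w₁)) := by
  set U := Measure.pi (fun _ : Fin n => (volume : Measure T3).prod (gaussMeasure w ϑ)) with hU
  set bs : Fin 1 → Fin n := ![b] with hbs
  set δs : Fin 1 → ℝ := ![w₁] with hδs
  have hinj : Function.Injective bs := fun i j _ => Subsingleton.elim i j
  have hne : ∀ i, bs i ≠ a := fun i => by fin_cases i; simpa [hbs] using hab
  have hδ0 : ∀ i, 0 ≤ δs i := fun i => by fin_cases i; simpa [hδs] using hw₁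
  have hδε : ∀ i, δs i ≤ ε := fun i => by fin_cases i; simpa [hδs] using hw₁ε
  set S : Set (Config n (Fin 3) T3) := {y | ∀ i, ε ≤ ‖(Torus.geometry (Fin 3)).sepVec (y a).1 (y (bs i)).1‖ ∧
      ‖(Torus.geometry (Fin 3)).sepVec (y a).1 (y (bs i)).1‖ ≤ ε + δs i * ‖(y a).2 - (y (bs i)).2‖} with hS
  set A : Set (Config n (Fin 3) T3) := {y : Config n (Fin 3) T3 | ε ≤ ‖(Torus.geometry (Fin 3)).sepVec (y a).1 (y b).1‖ ∧
        ‖(Torus.geometry (Fin 3)).sepVec (y a).1 (y b).1‖ ≤ ε + w₁ * ‖(y a).2 - (y b).2‖} ∩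
      {y | L ≤ δ * ‖(y a).2 - (y b).2‖} with hA
  have hAm : MeasurableSet A :=
    (measurableSet_velShell n ε w₁ a b).inter
      (measurableSet_le measurable_const
        (((measurable_pi_apply a).snd.sub (measurable_pi_apply b).snd).norm.const_mul δ))
  -- pointwise domination of the indicator of `A`
  have hpt : ∀ y, A.indicator (1 : Config n (Fin 3) T3 → ℝ≥0∞) y ≤
      ENNReal.ofReal ((δ / L) ^ 2) *
        S.indicator (fun y => ENNReal.ofReal ((1 + ‖(y a).2‖ + ∑ i, ‖(y (bs i)).2‖) ^ 2)) y := by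
    intro y
    by_cases hy : y ∈ A
    · have hyS : y ∈ S := by
        intro i
        fin_cases i
        simpa [hbs, hδs] using hy.1
      rw [Set.indicator_of_mem hy, Set.indicator_of_mem hyS, Pi.one_apply,
        ← ENNReal.ofReal_mul (by positivity), ← ENNReal.ofReal_one]
      refine ENNReal.ofReal_le_ofReal ?_
      have hfast : L ≤ δ * ‖(y a).2 - (y b).2‖ := hy.2
      have hsum : ∑ i, ‖(y (bs i)).2‖ = ‖(y b).2‖ := by
        rw [Fin.sum_univ_one]
        simp [hbs]
      rw [hsum]
      have h1 : 1 ≤ (δ / L) * ‖(y a).2 - (y b).2‖ := by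
        rw [div_mul_eq_mul_div, le_div_iff₀ hL, one_mul]
        exact hfast
      have h2 : ‖(y a).2 - (y b).2‖ ≤ 1 + ‖(y a).2‖ + ‖(y b).2‖ := by
        have := norm_sub_le (y a).2 (y b).2
        linarith
      have h3 : 1 ≤ (δ / L) * (1 + ‖(y a).2‖ + ‖(y b).2‖) :=
        h1.trans (mul_le_mul_of_nonneg_left h2 (by positivity))
      calc (1 : ℝ) = 1 ^ 2 := (one_pow 2).symm
        _ ≤ ((δ / L) * (1 + ‖(y a).2‖ + ‖(y b).2‖)) ^ 2 :=
            pow_le_pow_left₀ zero_le_one h3 2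
        _ = (δ / L) ^ 2 * (1 + ‖(y a).2‖ + ‖(y b).2‖) ^ 2 := by ring
    · rw [Set.indicator_of_notMem hy]
      exact zero_le
  have hkey := hC₁ n ε hε hε4 a bs hinj hne δs hδ0 hδε
  have hprod : ∏ i, δs i = w₁ := by rw [Fin.prod_univ_one]; simp [hδs]
  have hSmeas : Measurable fun y => S.indicator
      (fun y => ENNReal.ofReal ((1 + ‖(y a).2‖ + ∑ i, ‖(y (bs i)).2‖) ^ 2)) y := by
    have hSm : MeasurableSet S := by
      have : S = ⋂ i, {y : Config n (Fin 3) T3 | ε ≤ ‖(Torus.geometry (Fin 3)).sepVec (y a).1 (y (bs i)).1‖ ∧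
          ‖(Torus.geometry (Fin 3)).sepVec (y a).1 (y (bs i)).1‖ ≤ ε + δs i * ‖(y a).2 - (y (bs i)).2‖} := by
        ext y; simp [hS]
      rw [this]
      exact MeasurableSet.iInter fun i => measurableSet_velShell n ε (δs i) a (bs i)
    refine Measurable.indicator ?_ hSm
    refine ((measurable_const.add (measurable_pi_apply a).snd.norm).add ?_).pow_const 2 |>.ennreal_ofReal
    exact Finset.measurable_sum _ fun i _ => (measurable_pi_apply (bs i)).snd.norm
  calc U A = ∫⁻ y, A.indicator 1 y ∂U := (lintegral_indicator_one hAm).symm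
    _ ≤ ∫⁻ y, ENNReal.ofReal ((δ / L) ^ 2) *
          S.indicator (fun y => ENNReal.ofReal ((1 + ‖(y a).2‖ + ∑ i, ‖(y (bs i)).2‖) ^ 2)) y ∂U :=
        lintegral_mono hpt
    _ = ENNReal.ofReal ((δ / L) ^ 2) *
          ∫⁻ y, S.indicator (fun y => ENNReal.ofReal ((1 + ‖(y a).2‖ + ∑ i, ‖(y (bs i)).2‖) ^ 2)) y ∂U :=
        lintegral_const_mul _ hSmeas
    _ ≤ ENNReal.ofReal ((δ / L) ^ 2) * ENNReal.ofReal (C₁ * ε ^ (2 * 1) * ∏ i, δs i) := by gcongr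
    _ = ENNReal.ofReal ((δ / L) ^ 2 * (C₁ * ε ^ 2 * w₁)) := by
        rw [← ENNReal.ofReal_mul (by positivity), hprod]

/-! ## The Gibbs bound -/
/-- **The static bound behind the marked contacts** (registered stub `localGibbsLaw_markedShell_le` of
lead c10, piece W9 part 1).  For constant profiles `b, ϑ > 0`, `w` there is `C = C(w, ϑ) > 0` such that
for `0 < σ < 1/2`, `v₁σ³ ≤ 1/2`, every `N`, flow, `0 < δ` with `2δ ≤ ε = hsDiameter σ N ≤ 1/4`,
`0 < L`, `0 ≤ h' ≤ δ` and every ordered pair `q`: the rung-0 Gibbs probability that `q` is a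
non-degenerate `h'`-shell pair AND (a third particle lies in the `2δ`-shell of `q.1` or of `q.2`, or
`L ≤ δ ‖v_{q.1} − v_{q.2}‖`) is at most `C ((N+1) ε⁴ δ + ε² δ² / L²) h'` — union bound over `r`,
insertion bound `localGibbsLaw_le_pow_mul_pi` (`2³`, `2²`) and the free-law weights `pi_twoShells_le`,
`pi_fastShell_le`. [folklore] -/
theorem localGibbsLaw_markedShell_le :
    ∀ (b ϑ : ℝ) (w : V3), 0 < b → 0 < ϑ → ∃ C : ℝ, 0 < C ∧ ∀ σ : ℝ, 0 < σ → σ < 1 / 2 → v₁ * σ ^ 3 ≤ 1 / 2 →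
      ∀ (N : ℕ) (Φ : HardSphereFlow (Torus.geometry (Fin 3)) (hsDiameter σ N) (N + 1)) (δ L h' : ℝ),
        0 < δ → 2 * δ ≤ hsDiameter σ N → hsDiameter σ N ≤ 1 / 4 → 0 < L → 0 ≤ h' → h' ≤ δ →
        ∀ q : Fin (N + 1) × Fin (N + 1),
          localGibbsLaw σ (fun _ => b) (fun _ => w) (fun _ => ϑ) N Φ
              {y | (q.1 ≠ q.2 ∧ hsDiameter σ N ≤ ‖(Torus.geometry (Fin 3)).sepVec (y q.1).1 (y q.2).1‖ ∧
                  ‖(Torus.geometry (Fin 3)).sepVec (y q.1).1 (y q.2).1‖ ≤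
                    hsDiameter σ N + h' * ‖(y q.1).2 - (y q.2).2‖) ∧
                ((∃ r : Fin (N + 1), r ≠ q.1 ∧ r ≠ q.2 ∧
                    ((hsDiameter σ N ≤ ‖(Torus.geometry (Fin 3)).sepVec (y q.1).1 (y r).1‖ ∧
                        ‖(Torus.geometry (Fin 3)).sepVec (y q.1).1 (y r).1‖ ≤
                          hsDiameter σ N + (2 * δ) * ‖(y q.1).2 - (y r).2‖) ∨
                      (hsDiameter σ N ≤ ‖(Torus.geometry (Fin 3)).sepVec (y q.2).1 (y r).1‖ ∧
                        ‖(Torus.geometry (Fin 3)).sepVec (y q.2).1 (y r).1‖ ≤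
                          hsDiameter σ N + (2 * δ) * ‖(y q.2).2 - (y r).2‖))) ∨
                  L ≤ δ * ‖(y q.1).2 - (y q.2).2‖)} ≤
            ENNReal.ofReal (C * (((N : ℝ) + 1) * hsDiameter σ N ^ 4 * δ + hsDiameter σ N ^ 2 * δ ^ 2 / L ^ 2) * h') := by
  intro b ϑ w hb hϑ
  obtain ⟨C₂, hC₂pos, hC₂⟩ := pi_starShells_le w ϑ 2 0
  obtain ⟨C₁, hC₁pos, hC₁⟩ := pi_starShells_le w ϑ 1 2
  refine ⟨32 * C₂ + 4 * C₁, by positivity, ?_⟩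
  intro σ hσ hσ2 hlam N Φ δ L h' hδ h2δ hε4 hL hh' hh'δ q
  set ε := hsDiameter σ N with hε
  have hεpos : 0 < ε := hsDiameter_pos hσ N
  set G := localGibbsLaw σ (fun _ => b) (fun _ => w) (fun _ => ϑ) N Φ
  set U := Measure.pi (fun _ : Fin (N + 1) => (volume : Measure T3).prod (gaussMeasure w ϑ))
  have h'ε : h' ≤ ε := hh'δ.trans (by linarith)
  have h2δ0 : 0 ≤ 2 * δ := by linarith
  -- degenerate pair: the event is empty
  by_cases hq : q.1 = q.2
  · refine le_of_eq_of_le (measure_mono_null (fun y hy => hy.1.1 hq) measure_empty) zero_le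
  -- the three pieces
  set A : Fin (N + 1) → Set (Config (N + 1) (Fin 3) T3) := fun r =>
    {y | r ≠ q.1 ∧ r ≠ q.2} ∩
      ({y | ε ≤ ‖(Torus.geometry (Fin 3)).sepVec (y q.1).1 (y q.2).1‖ ∧
          ‖(Torus.geometry (Fin 3)).sepVec (y q.1).1 (y q.2).1‖ ≤ ε + h' * ‖(y q.1).2 - (y q.2).2‖} ∩
        {y | ε ≤ ‖(Torus.geometry (Fin 3)).sepVec (y q.1).1 (y r).1‖ ∧
          ‖(Torus.geometry (Fin 3)).sepVec (y q.1).1 (y r).1‖ ≤ ε + (2 * δ) * ‖(y q.1).2 - (y r).2‖}) with hA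
  set A' : Fin (N + 1) → Set (Config (N + 1) (Fin 3) T3) := fun r =>
    {y | r ≠ q.1 ∧ r ≠ q.2} ∩
      ({y | ε ≤ ‖(Torus.geometry (Fin 3)).sepVec (y q.2).1 (y q.1).1‖ ∧
          ‖(Torus.geometry (Fin 3)).sepVec (y q.2).1 (y q.1).1‖ ≤ ε + h' * ‖(y q.2).2 - (y q.1).2‖} ∩
        {y | ε ≤ ‖(Torus.geometry (Fin 3)).sepVec (y q.2).1 (y r).1‖ ∧
          ‖(Torus.geometry (Fin 3)).sepVec (y q.2).1 (y r).1‖ ≤ ε + (2 * δ) * ‖(y q.2).2 - (y r).2‖}) with hA'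
  set Fst : Set (Config (N + 1) (Fin 3) T3) :=
    {y | ε ≤ ‖(Torus.geometry (Fin 3)).sepVec (y q.1).1 (y q.2).1‖ ∧
        ‖(Torus.geometry (Fin 3)).sepVec (y q.1).1 (y q.2).1‖ ≤ ε + h' * ‖(y q.1).2 - (y q.2).2‖} ∩
      {y | L ≤ δ * ‖(y q.1).2 - (y q.2).2‖} with hFst
  have hsub : {y : Config (N + 1) (Fin 3) T3 | (q.1 ≠ q.2 ∧ ε ≤ ‖(Torus.geometry (Fin 3)).sepVec (y q.1).1 (y q.2).1‖ ∧
          ‖(Torus.geometry (Fin 3)).sepVec (y q.1).1 (y q.2).1‖ ≤ ε + h' * ‖(y q.1).2 - (y q.2).2‖) ∧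
        ((∃ r : Fin (N + 1), r ≠ q.1 ∧ r ≠ q.2 ∧
            ((ε ≤ ‖(Torus.geometry (Fin 3)).sepVec (y q.1).1 (y r).1‖ ∧
                ‖(Torus.geometry (Fin 3)).sepVec (y q.1).1 (y r).1‖ ≤ ε + (2 * δ) * ‖(y q.1).2 - (y r).2‖) ∨
              (ε ≤ ‖(Torus.geometry (Fin 3)).sepVec (y q.2).1 (y r).1‖ ∧
                ‖(Torus.geometry (Fin 3)).sepVec (y q.2).1 (y r).1‖ ≤ ε + (2 * δ) * ‖(y q.2).2 - (y r).2‖))) ∨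
          L ≤ δ * ‖(y q.1).2 - (y q.2).2‖)} ⊆ ((⋃ r, A r) ∪ (⋃ r, A' r)) ∪ Fst := by
    intro y hy
    obtain ⟨⟨-, hsh⟩, hmark⟩ := hy
    rcases hmark with ⟨r, hr1, hr2, hr | hr⟩ | hfast
    · exact Or.inl (Or.inl (Set.mem_iUnion.2 ⟨r, ⟨hr1, hr2⟩, hsh, hr⟩))
    · exact Or.inl (Or.inr (Set.mem_iUnion.2 ⟨r, ⟨hr1, hr2⟩, velShell_symm hsh, hr⟩))
    · exact Or.inr ⟨hsh, hfast⟩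
  -- measurability
  have hShm : ∀ (wd : ℝ) (i j : Fin (N + 1)), MeasurableSet
      {y : Config (N + 1) (Fin 3) T3 | ε ≤ ‖(Torus.geometry (Fin 3)).sepVec (y i).1 (y j).1‖ ∧
        ‖(Torus.geometry (Fin 3)).sepVec (y i).1 (y j).1‖ ≤ ε + wd * ‖(y i).2 - (y j).2‖} :=
    fun wd i j => measurableSet_velShell (N + 1) ε wd i j
  have hAm : ∀ r, MeasurableSet (A r) := fun r =>
    (MeasurableSet.const _).inter ((hShm h' q.1 q.2).inter (hShm (2 * δ) q.1 r))
  have hA'm : ∀ r, MeasurableSet (A' r) := fun r =>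
    (MeasurableSet.const _).inter ((hShm h' q.2 q.1).inter (hShm (2 * δ) q.2 r))
  have hFstm : MeasurableSet Fst :=
    (hShm h' q.1 q.2).inter (measurableSet_le measurable_const
      (((measurable_pi_apply q.1).snd.sub (measurable_pi_apply q.2).snd).norm.const_mul δ))
  -- the insertion step for each piece
  have hins : ∀ (I : Finset (Fin (N + 1))) (B : Set (Config (N + 1) (Fin 3) T3)), MeasurableSet B →
      (∀ y y' : Config (N + 1) (Fin 3) T3, (∀ i ∈ I, y i = y' i) → (y ∈ B ↔ y' ∈ B)) →
      G B ≤ 2 ^ I.card * U B :=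
    fun I B hBm hBI => localGibbsLaw_le_pow_mul_pi b ϑ w hb hϑ σ hσ hσ2 hlam N Φ I B hBm hBI
  have hcard3 : ∀ r, 2 ^ ({q.1, q.2, r} : Finset (Fin (N + 1))).card ≤ (8 : ℝ≥0∞) := fun r =>
    calc (2 : ℝ≥0∞) ^ ({q.1, q.2, r} : Finset (Fin (N + 1))).card ≤ 2 ^ 3 :=
          pow_le_pow_right₀ one_le_two Finset.card_le_three
      _ = 8 := by norm_num
  -- piece 1: stars with centre q.1
  have hpiece1 : ∀ r, G (A r) ≤ 8 * ENNReal.ofReal (C₂ * ε ^ 4 * (h' * (2 * δ))) := by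
    intro r
    by_cases hr : r ≠ q.1 ∧ r ≠ q.2
    · have hI : ∀ y y' : Config (N + 1) (Fin 3) T3, (∀ i ∈ ({q.1, q.2, r} : Finset (Fin (N + 1))), y i = y' i) →
          (y ∈ A r ↔ y' ∈ A r) := by
        intro y y' hyy'
        simp only [hA, Set.mem_inter_iff, Set.mem_setOf_eq, hyy' q.1 (by simp), hyy' q.2 (by simp),
          hyy' r (by simp)]
      have hUA : U (A r) ≤ ENNReal.ofReal (C₂ * ε ^ 4 * (h' * (2 * δ))) :=
        (measure_mono Set.inter_subset_right).trans
          (pi_twoShells_le w ϑ hC₂ hεpos hε4 hh' h'ε h2δ0 h2δ (Ne.symm hq) hr.1 (Ne.symm hr.2))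
      calc G (A r) ≤ 2 ^ ({q.1, q.2, r} : Finset (Fin (N + 1))).card * U (A r) :=
            hins {q.1, q.2, r} (A r) (hAm r) hI
        _ ≤ 8 * ENNReal.ofReal (C₂ * ε ^ 4 * (h' * (2 * δ))) := mul_le_mul' (hcard3 r) hUA
    · have h0 : A r ⊆ ∅ := fun y hy => hr hy.1
      exact (measure_mono_null h0 measure_empty).trans_le zero_le
  -- piece 2: stars with centre q.2
  have hpiece2 : ∀ r, G (A' r) ≤ 8 * ENNReal.ofReal (C₂ * ε ^ 4 * (h' * (2 * δ))) := by
    intro r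
    by_cases hr : r ≠ q.1 ∧ r ≠ q.2
    · have hI : ∀ y y' : Config (N + 1) (Fin 3) T3, (∀ i ∈ ({q.1, q.2, r} : Finset (Fin (N + 1))), y i = y' i) →
          (y ∈ A' r ↔ y' ∈ A' r) := by
        intro y y' hyy'
        simp only [hA', Set.mem_inter_iff, Set.mem_setOf_eq, hyy' q.1 (by simp), hyy' q.2 (by simp),
          hyy' r (by simp)]
      have hUA : U (A' r) ≤ ENNReal.ofReal (C₂ * ε ^ 4 * (h' * (2 * δ))) :=
        (measure_mono Set.inter_subset_right).trans
          (pi_twoShells_le w ϑ hC₂ hεpos hε4 hh' h'ε h2δ0 h2δ hq hr.2 (Ne.symm hr.1))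
      calc G (A' r) ≤ 2 ^ ({q.1, q.2, r} : Finset (Fin (N + 1))).card * U (A' r) :=
            hins {q.1, q.2, r} (A' r) (hA'm r) hI
        _ ≤ 8 * ENNReal.ofReal (C₂ * ε ^ 4 * (h' * (2 * δ))) := mul_le_mul' (hcard3 r) hUA
    · have h0 : A' r ⊆ ∅ := fun y hy => hr hy.1
      exact (measure_mono_null h0 measure_empty).trans_le zero_le
  -- piece 3: the fast pair
  have hpiece3 : G Fst ≤ 4 * ENNReal.ofReal ((δ / L) ^ 2 * (C₁ * ε ^ 2 * h')) := by
    have hI : ∀ y y' : Config (N + 1) (Fin 3) T3, (∀ i ∈ ({q.1, q.2} : Finset (Fin (N + 1))), y i = y' i) →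
        (y ∈ Fst ↔ y' ∈ Fst) := by
      intro y y' hyy'
      simp only [hFst, Set.mem_inter_iff, Set.mem_setOf_eq, hyy' q.1 (by simp), hyy' q.2 (by simp)]
    have hcard : 2 ^ ({q.1, q.2} : Finset (Fin (N + 1))).card ≤ (4 : ℝ≥0∞) := by
      calc (2 : ℝ≥0∞) ^ ({q.1, q.2} : Finset (Fin (N + 1))).card ≤ 2 ^ 2 :=
            pow_le_pow_right₀ one_le_two Finset.card_le_two
        _ = 4 := by norm_num
    have hUA : U Fst ≤ ENNReal.ofReal ((δ / L) ^ 2 * (C₁ * ε ^ 2 * h')) :=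
      pi_fastShell_le w ϑ hC₁ hεpos hε4 hh' h'ε hδ.le hL (Ne.symm hq)
    calc G Fst ≤ 2 ^ ({q.1, q.2} : Finset (Fin (N + 1))).card * U Fst := hins {q.1, q.2} Fst hFstm hI
      _ ≤ 4 * ENNReal.ofReal ((δ / L) ^ 2 * (C₁ * ε ^ 2 * h')) := mul_le_mul' hcard hUA
  -- assembly: everything as `ofReal` of reals
  set x : ℝ := C₂ * ε ^ 4 * (h' * (2 * δ)) with hx
  set yv : ℝ := (δ / L) ^ 2 * (C₁ * ε ^ 2 * h') with hyv
  have e8 : (8 : ℝ≥0∞) * ENNReal.ofReal x = ENNReal.ofReal (8 * x) := by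
    rw [show (8 : ℝ≥0∞) = ENNReal.ofReal 8 by norm_num, ← ENNReal.ofReal_mul (by norm_num)]
  have e4 : (4 : ℝ≥0∞) * ENNReal.ofReal yv = ENNReal.ofReal (4 * yv) := by
    rw [show (4 : ℝ≥0∞) = ENNReal.ofReal 4 by norm_num, ← ENNReal.ofReal_mul (by norm_num)]
  have esum : ∑ _r : Fin (N + 1), (8 : ℝ≥0∞) * ENNReal.ofReal x =
      ENNReal.ofReal ((((N + 1 : ℕ) : ℝ)) * (8 * x)) := by
    rw [Finset.sum_const, Finset.card_univ, Fintype.card_fin, nsmul_eq_mul, e8,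
      ENNReal.ofReal_mul (Nat.cast_nonneg _), ENNReal.ofReal_natCast]
  have hNx : 0 ≤ ((N + 1 : ℕ) : ℝ) * (8 * x) := by positivity
  calc G _ ≤ G (((⋃ r, A r) ∪ (⋃ r, A' r)) ∪ Fst) := measure_mono hsub
    _ ≤ G ((⋃ r, A r) ∪ (⋃ r, A' r)) + G Fst := measure_union_le _ _
    _ ≤ (G (⋃ r, A r) + G (⋃ r, A' r)) + G Fst := by gcongr; exact measure_union_le _ _
    _ ≤ ((∑ r, G (A r)) + ∑ r, G (A' r)) + G Fst := by
        gcongr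
        · exact measure_iUnion_fintype_le _ _
        · exact measure_iUnion_fintype_le _ _
    _ ≤ ((∑ _r : Fin (N + 1), 8 * ENNReal.ofReal x) + ∑ _r : Fin (N + 1), 8 * ENNReal.ofReal x) +
          4 * ENNReal.ofReal yv := by
        gcongr with r _ r _
        · exact hpiece1 r
        · exact hpiece2 r
    _ = ENNReal.ofReal ((((N + 1 : ℕ) : ℝ) * (8 * x) + ((N + 1 : ℕ) : ℝ) * (8 * x)) + 4 * yv) := by
        rw [esum, e4, ← ENNReal.ofReal_add hNx hNx,
          ← ENNReal.ofReal_add (add_nonneg hNx hNx) (by positivity)]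
    _ ≤ ENNReal.ofReal ((32 * C₂ + 4 * C₁) * (((N : ℝ) + 1) * ε ^ 4 * δ + ε ^ 2 * δ ^ 2 / L ^ 2) * h') := by
        refine ENNReal.ofReal_le_ofReal ?_
        have e1 : (((N + 1 : ℕ) : ℝ) * (8 * x) + ((N + 1 : ℕ) : ℝ) * (8 * x)) =
            32 * C₂ * (((N : ℝ) + 1) * ε ^ 4 * δ) * h' := by
          rw [hx]; push_cast; ring
        have e2 : 4 * yv = 4 * C₁ * (ε ^ 2 * δ ^ 2 / L ^ 2) * h' := by
          rw [hyv, div_pow]; ring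
        rw [e1, e2]
        have h1 : 0 ≤ ((N : ℝ) + 1) * ε ^ 4 * δ := by positivity
        have h2 : 0 ≤ ε ^ 2 * δ ^ 2 / L ^ 2 := by positivity
        nlinarith [mul_nonneg (mul_nonneg (by positivity : (0 : ℝ) ≤ 32 * C₂) h2) hh',
          mul_nonneg (mul_nonneg (by positivity : (0 : ℝ) ≤ 4 * C₁) h1) hh']
end Summit.AtomisticToContinuum.HydrodynamicLimit.Theorems.LambertianContactSwapLambertianEulerMarkedContactsStatics

end
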